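import Literature.MathematicalPhysics.QuantumLattice.LindhardSliceKeyLemma
import Literature.MathematicalPhysics.QuantumLattice.AnisotropicBandDOSFinite
import Literature.MathematicalPhysics.QuantumLattice.LindhardSRepTools
import Mathlib.MeasureTheory.Integral.Prod
import HarnessLib

/-!
# The s-representation of the square-lattice Lindhard function (pointwise identification)

Cell `gate-hubbard-kl`, item stmt-HubbardSuperconductivity-19294 `LindhardPointwiseIdentification`
(REF-CHECK §8.7 (β) for both Kohn–Luttinger certificates stmt-0158 / stmt-1741; CERT-SREP §1
Prop. 1–2). **Theorem** (`lindhardFunction_squareDispersion_eq_sRepresentation`): for every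
`-4 < μ < 0` and every `q ∈ ℝ²` with some coordinate `q_i ∉ 2πℤ`,

  `lindhardFunction ε₀ μ q = (∫ s in 0..1, (fermiCurveMeasure ε_s μ univ).toReal ds) / (2π)²`,
  `ε₀(k) = -2(cos k₀ + cos k₁)`, `ε_s(k) = -2(A₀(s) cos k₀ + A₁(s) cos k₁)`, `A_i(s) = √(1 - 4s(1-s) sin²(q_i/2))`:

the zero-temperature Lindhard function (Raghu–Kivelson–Scalapino eq. (5)) equals the `s`-average of
the total density-of-states mass of the interpolated anisotropic band (`(1-s) cos k + s cos(k+q_i) =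
A_i(s) cos(k + φ_i(s))`, the Feynman-parametrised form `(f(x)-f(y))/(y-x) = ∫₀¹(-f')((1-s)x+sy) ds`),
POINTWISE in `μ` — no continuity-in-`μ` or caustic argument is needed. Proof (all in `ℝ≥0∞` until the
last line): Fubini in `p = (x, y)` (`measurePreserving_momentum_prod`); for a.e. `x` the one-dimensional
key lemma `keyLemma_lindhard_slice` (`LindhardSliceKeyLemma.lean`; the exceptional `x` are null by
`LindhardSRepTools.lean`); Tonelli in `(x, s)`; the phase form and `2π`-translation invariance in `x`;
Step A `fermiCurveMeasure_anisoBand_univ` (`AnisotropicBandFermiCurveMeasure.lean`); finally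
`∫ toReal = toReal ∫⁻` because `fermiCurveMeasure ε_s μ univ < ∞` off the finitely many van Hove
parameters (`AnisotropicBandDOSFinite.lean`, `finite_setOf_vanHove` — the only place `μ ∈ (-4,0)`
enters). Theorems only; the 3-line closer of the Theses item imports this file.

## References
* S. Raghu, S. A. Kivelson, D. J. Scalapino, Phys. Rev. B 81 (2010) 224505, §II eq. (5)–(6)
  [RaghuKivelsonScalapino2010].
-/

noncomputable section

open Real Set MeasureTheory MeasureTheory.Measure Filter
open scoped Topology ENNReal

namespace Literature.MathematicalPhysics.QuantumLattice

/-! ### The `x`-integral at fixed `s`: phase form, translation, Step A -/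

/-- At fixed `s ∈ [0,1]`, the `x`-integral of the Feynman-parametrised integrand is the Step-A
integral of the anisotropic band with hoppings `(A₀(s), A₁(s))` (phase shift `x ↦ x + φ₀(s)`).
[cite: RaghuKivelsonScalapino2010, §II (5)] -/
theorem sRep_inner_x_eq (μ q₀ q₁ s : ℝ) (hs : s ∈ Icc (0 : ℝ) 1) :
    ∫⁻ x in Ico (-π) π, ENNReal.ofReal (2 / Real.sqrt (4 * (1 - 4 * s * (1 - s) * Real.sin (q₁ / 2) ^ 2) -
        (μ + 2 * Real.cos x - s * (2 * Real.cos x - 2 * Real.cos (x + q₀))) ^ 2)) =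
      ∫⁻ x in Ico (-π) π, ENNReal.ofReal (2 / Real.sqrt (4 * Real.sqrt (1 - 4 * s * (1 - s) * Real.sin (q₁ / 2) ^ 2) ^ 2 -
        (μ + 2 * Real.sqrt (1 - 4 * s * (1 - s) * Real.sin (q₀ / 2) ^ 2) * Real.cos x) ^ 2)) := by
  obtain ⟨A, φ, hA0, hA2, hφ⟩ := aniso_phase_exists s q₀
  have hss : 0 ≤ 4 * s * (1 - s) ∧ 4 * s * (1 - s) ≤ 1 := by
    constructor <;> nlinarith [hs.1, hs.2, sq_nonneg (2 * s - 1)]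
  have hR₁ : 0 ≤ 1 - 4 * s * (1 - s) * Real.sin (q₁ / 2) ^ 2 := by
    nlinarith [Real.sin_sq_le_one (q₁ / 2), sq_nonneg (Real.sin (q₁ / 2))]
  have hA : Real.sqrt (1 - 4 * s * (1 - s) * Real.sin (q₀ / 2) ^ 2) = A := by
    rw [← hA2, Real.sqrt_sq hA0]
  rw [hA, Real.sq_sqrt hR₁]
  set M : ℝ → ℝ≥0∞ := fun u => ENNReal.ofReal (2 / Real.sqrt (4 * (1 - 4 * s * (1 - s) * Real.sin (q₁ / 2) ^ 2) -
    (μ + 2 * A * Real.cos u) ^ 2)) with hM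
  have hper : Function.Periodic M (2 * π) := fun u => by simp only [hM, Real.cos_add_two_pi]
  have hlhs : (fun x : ℝ => ENNReal.ofReal (2 / Real.sqrt (4 * (1 - 4 * s * (1 - s) * Real.sin (q₁ / 2) ^ 2) -
      (μ + 2 * Real.cos x - s * (2 * Real.cos x - 2 * Real.cos (x + q₀))) ^ 2))) = fun x => M (x + φ) := by
    funext x
    simp only [hM]
    rw [show μ + 2 * Real.cos x - s * (2 * Real.cos x - 2 * Real.cos (x + q₀)) =
      μ + 2 * ((1 - s) * Real.cos x + s * Real.cos (x + q₀)) by ring, (hφ x).1]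
    ring_nf
  rw [hlhs, setLIntegral_Ico_comp_add_of_periodic hper φ]

/-! ### The main theorem -/

/-- **The s-representation of the square-lattice Lindhard function, pointwise.** For `-4 < μ < 0`
and `q` with some coordinate off `2πℤ`:
`lindhardFunction ε₀ μ q = (∫₀¹ (fermiCurveMeasure ε_s μ univ).toReal ds)/(2π)²` with
`ε_s(k) = -2(A₀(s) cos k₀ + A₁(s) cos k₁)`, `A_i(s) = √(1 - 4s(1-s) sin²(q_i/2))` — exactly the shape of
the Theses item `LindhardPointwiseIdentification`. [cite: RaghuKivelsonScalapino2010, §II (5)] -/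
theorem lindhardFunction_squareDispersion_eq_sRepresentation (μ : ℝ) (hμ : μ ∈ Ioo (-4 : ℝ) 0) (q : Momentum)
    (hq : ∃ i : Fin 2, ∀ n : ℤ, q i ≠ 2 * Real.pi * n) :
    lindhardFunction (squareDispersion 1 0) μ q =
      (∫ s in (0 : ℝ)..1, (fermiCurveMeasure (fun k : Momentum =>
        -2 * (Real.sqrt (1 - 4 * s * (1 - s) * Real.sin (q 0 / 2) ^ 2) * Real.cos (k 0) +
          Real.sqrt (1 - 4 * s * (1 - s) * Real.sin (q 1 / 2) ^ 2) * Real.cos (k 1))) μ Set.univ).toReal) /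
        (2 * Real.pi) ^ 2 := by
  obtain ⟨hμ4, hμ0⟩ := hμ
  have hπ := Real.pi_pos
  -- `q ∉ 2πℤ²` in trigonometric form
  have hq' : Real.sin (q 0 / 2) ≠ 0 ∨ Real.sin (q 1 / 2) ≠ 0 := by
    obtain ⟨i, hi⟩ := hq
    have hsin : Real.sin (q i / 2) ≠ 0 := by
      intro h0
      obtain ⟨n, hn⟩ := Real.sin_eq_zero_iff.1 h0
      exact hi n (by linarith)
    fin_cases i
    · exact Or.inl hsin
    · exact Or.inr hsin
  ---------------------------------------------------------------------------------------------
  -- notation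
  ---------------------------------------------------------------------------------------------
  set σ : ℝ → ℝ≥0∞ := fun s => fermiCurveMeasure (fun k : Momentum =>
    -2 * (Real.sqrt (1 - 4 * s * (1 - s) * Real.sin (q 0 / 2) ^ 2) * Real.cos (k 0) +
      Real.sqrt (1 - 4 * s * (1 - s) * Real.sin (q 1 / 2) ^ 2) * Real.cos (k 1))) μ Set.univ with hσ
  set N : ℝ → ℝ → ℝ≥0∞ := fun s x => ENNReal.ofReal (2 / Real.sqrt (4 * (1 - 4 * s * (1 - s) * Real.sin (q 1 / 2) ^ 2) -
    (μ + 2 * Real.cos x - s * (2 * Real.cos x - 2 * Real.cos (x + q 0))) ^ 2)) with hN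
  set L : ℝ → ℝ → ℝ≥0∞ := fun x y => ENNReal.ofReal
    (if (-2 * (Real.cos x + Real.cos y) < μ ↔ -2 * (Real.cos (x + q 0) + Real.cos (y + q 1)) < μ) then (0 : ℝ)
      else 1 / (|-2 * (Real.cos x + Real.cos y) - μ| + |-2 * (Real.cos (x + q 0) + Real.cos (y + q 1)) - μ|)) with hL
  have hNm : Measurable (Function.uncurry fun x s => N s x) := by
    rw [hN]
    exact (by fun_prop : Measurable fun z : ℝ × ℝ => 2 / Real.sqrt (4 * (1 - 4 * z.2 * (1 - z.2) * Real.sin (q 1 / 2) ^ 2) -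
      (μ + 2 * Real.cos z.1 - z.2 * (2 * Real.cos z.1 - 2 * Real.cos (z.1 + q 0))) ^ 2)).ennreal_ofReal
  have hNm' : Measurable (Function.uncurry N) := by
    rw [hN]
    exact (by fun_prop : Measurable fun z : ℝ × ℝ => 2 / Real.sqrt (4 * (1 - 4 * z.1 * (1 - z.1) * Real.sin (q 1 / 2) ^ 2) -
      (μ + 2 * Real.cos z.2 - z.1 * (2 * Real.cos z.2 - 2 * Real.cos (z.2 + q 0))) ^ 2)).ennreal_ofReal
  ---------------------------------------------------------------------------------------------
  -- Step 1: the Lindhard integral as an iterated Lebesgue integral over `[-π,π)²`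
  ---------------------------------------------------------------------------------------------
  have hε : squareDispersion 1 0 = fun k : Momentum => -2 * (Real.cos (k 0) + Real.cos (k 1)) := by
    funext k; simp only [squareDispersion]; ring
  have hεm : Measurable (squareDispersion 1 0) := by rw [hε]; fun_prop
  have hLIm : Measurable (lindhardIntegrand (squareDispersion 1 0) μ q) := measurable_lindhardIntegrand hεm μ q
  have hLInn : ∀ p, 0 ≤ lindhardIntegrand (squareDispersion 1 0) μ q p := fun p => by
    rw [lindhardIntegrand_eq_ite_inv]; split_ifs <;> positivity
  have h1 : ∫ p in brillouinZone, lindhardIntegrand (squareDispersion 1 0) μ q p =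
      (∫⁻ p in brillouinZone, ENNReal.ofReal (lindhardIntegrand (squareDispersion 1 0) μ q p)).toReal :=
    integral_eq_lintegral_of_nonneg_ae (Eventually.of_forall hLInn) hLIm.aestronglyMeasurable
  -- to coordinates
  set T : ℝ × ℝ → Momentum := fun z => WithLp.toLp 2 ![z.1, z.2] with hT
  have hTm : Measurable T := by
    refine (PiLp.continuous_toLp 2 _).measurable.comp (measurable_pi_iff.2 fun i => ?_)
    fin_cases i
    · simpa using measurable_fst
    · simpa using measurable_snd
  have hTg : ∀ k : Momentum, T (k 0, k 1) = k := fun k => by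
    ext i; fin_cases i <;> simp [hT]
  have hBZ : brillouinZone = (fun k : Momentum => (k 0, k 1)) ⁻¹' (Ico (-π) π ×ˢ Ico (-π) π) := by
    ext k; simp [brillouinZone, Fin.forall_fin_two, mem_prod]
  have hFm : Measurable (fun z : ℝ × ℝ => ENNReal.ofReal (lindhardIntegrand (squareDispersion 1 0) μ q (T z))) :=
    (hLIm.comp hTm).ennreal_ofReal
  have h2 : ∫⁻ p in brillouinZone, ENNReal.ofReal (lindhardIntegrand (squareDispersion 1 0) μ q p) =
      ∫⁻ z in Ico (-π) π ×ˢ Ico (-π) π, ENNReal.ofReal (lindhardIntegrand (squareDispersion 1 0) μ q (T z)) := by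
    rw [hBZ, ← measurePreserving_momentum_prod.setLIntegral_comp_preimage
      ((measurableSet_Ico (a := -π) (b := π)).prod (measurableSet_Ico (a := -π) (b := π))) hFm]
    simp only [hTg]
  have hLI_T : ∀ z : ℝ × ℝ, ENNReal.ofReal (lindhardIntegrand (squareDispersion 1 0) μ q (T z)) = L z.1 z.2 := by
    intro z
    rw [lindhardIntegrand_squareDispersion_eq]
    simp [hT, hL]
  have h3 : ∫⁻ z in Ico (-π) π ×ˢ Ico (-π) π, ENNReal.ofReal (lindhardIntegrand (squareDispersion 1 0) μ q (T z)) =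
      ∫⁻ x in Ico (-π) π, ∫⁻ y in Ico (-π) π, L x y := by
    rw [show (volume : Measure (ℝ × ℝ)) = (volume : Measure ℝ).prod volume from rfl, ← Measure.prod_restrict,
      lintegral_prod _ hFm.aemeasurable]
    simp only [hLI_T]
  ---------------------------------------------------------------------------------------------
  -- Step 2: the key lemma on a.e. line `k₀ = x`
  ---------------------------------------------------------------------------------------------
  have hBad : ∀ᵐ x ∂(volume : Measure ℝ),
      (Real.sin (q 1 / 2) ≠ 0 ∨ 2 * Real.cos x - 2 * Real.cos (x + q 0) ≠ 0) ∧
      (∀ y : ℝ, (2 * Real.cos x - 2 * Real.cos (x + q 0)) + (2 * Real.cos y - 2 * Real.cos (y + q 1)) = 0 →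
        -2 * Real.cos y ≠ μ + 2 * Real.cos x) ∧
      ¬ (Real.sin (q 1 / 2) ^ 2 = 1 ∧ 2 * (μ + 2 * Real.cos x) = 2 * Real.cos x - 2 * Real.cos (x + q 0)) := by
    refine (?_ : ∀ᵐ x ∂(volume : Measure ℝ), _).and ((?_ : ∀ᵐ x ∂(volume : Measure ℝ), _).and ?_)
    · -- (H1)
      by_cases hs1 : Real.sin (q 1 / 2) = 0
      · have hs0 : Real.sin (q 0 / 2) ≠ 0 := hq'.resolve_right (fun h => h hs1)
        refine (measure_eq_zero_iff_ae_notMem.1 (volume_setOf_dZero_eq_zero (q 0) hs0)).mono fun x hx => ?_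
        exact Or.inr hx
      · exact Eventually.of_forall fun x => Or.inl hs1
    · -- (H2)
      refine (measure_eq_zero_iff_ae_notMem.1 (volume_setOf_crossing_eq_zero μ (q 0) (q 1) hμ0 hq')).mono
        fun x hx => ?_
      intro y hD ht
      exact hx ⟨y, hD, ht⟩
    · -- (H3)
      refine (measure_eq_zero_iff_ae_notMem.1 (volume_setOf_degenerate_eq_zero μ (q 0) hμ0.ne)).mono
        fun x hx => ?_
      exact fun h => hx h.2
  have h4 : ∫⁻ x in Ico (-π) π, ∫⁻ y in Ico (-π) π, L x y = ∫⁻ x in Ico (-π) π, ∫⁻ s in Ioo (0 : ℝ) 1, N s x := by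
    refine lintegral_congr_ae ((ae_restrict_of_ae hBad).mono fun x hx => ?_)
    obtain ⟨H1, H2, H3⟩ := hx
    dsimp only
    have hKL : (∫⁻ y in Ico (-π) π, ENNReal.ofReal (if (-2 * Real.cos y < μ + 2 * Real.cos x ↔
        -2 * Real.cos (y + q 1) + (2 * Real.cos x - 2 * Real.cos (x + q 0)) < μ + 2 * Real.cos x) then (0 : ℝ)
        else 1 / (|-2 * Real.cos y - (μ + 2 * Real.cos x)| +
          |-2 * Real.cos (y + q 1) + (2 * Real.cos x - 2 * Real.cos (x + q 0)) - (μ + 2 * Real.cos x)|))) =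
        ∫⁻ s in Ioo (0 : ℝ) 1, N s x :=
      keyLemma_lindhard_slice (μ + 2 * Real.cos x) (2 * Real.cos x - 2 * Real.cos (x + q 0)) (q 1) H1 H2 H3
    rw [← hKL]
    refine lintegral_congr fun y => ?_
    simp only [hL]
    have e1 : (-2 * (Real.cos x + Real.cos y) < μ) ↔ (-2 * Real.cos y < μ + 2 * Real.cos x) := by
      constructor <;> intro h <;> linarith
    have e2 : (-2 * (Real.cos (x + q 0) + Real.cos (y + q 1)) < μ) ↔
        (-2 * Real.cos (y + q 1) + (2 * Real.cos x - 2 * Real.cos (x + q 0)) < μ + 2 * Real.cos x) := by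
      constructor <;> intro h <;> linarith
    have e3 : |-2 * (Real.cos x + Real.cos y) - μ| = |-2 * Real.cos y - (μ + 2 * Real.cos x)| := by
      congr 1; ring
    have e4 : |-2 * (Real.cos (x + q 0) + Real.cos (y + q 1)) - μ| =
        |-2 * Real.cos (y + q 1) + (2 * Real.cos x - 2 * Real.cos (x + q 0)) - (μ + 2 * Real.cos x)| := by
      congr 1; ring
    simp only [e1, e2, e3, e4]
  ---------------------------------------------------------------------------------------------
  -- Step 3: Tonelli in `(x, s)` and the `x`-integral at fixed `s`
  ---------------------------------------------------------------------------------------------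
  have h5 : ∫⁻ x in Ico (-π) π, ∫⁻ s in Ioo (0 : ℝ) 1, N s x = ∫⁻ s in Ioo (0 : ℝ) 1, ∫⁻ x in Ico (-π) π, N s x :=
    lintegral_lintegral_swap hNm.aemeasurable
  have hhalf : (volume : Measure ℝ) {(1 / 2 : ℝ)} = 0 := measure_singleton _
  -- `x`-integral at `s`: Step A (for `s ≠ 1/2` the second hopping is positive)
  have hR₁pos : ∀ s ∈ Ioo (0 : ℝ) 1, s ≠ 1 / 2 → 0 < 1 - 4 * s * (1 - s) * Real.sin (q 1 / 2) ^ 2 := by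
    intro s hs hs2
    have h1 : 4 * s * (1 - s) < 1 := by nlinarith [sq_nonneg (2 * s - 1), sq_pos_of_ne_zero (sub_ne_zero.2 hs2)]
    have h2 : 0 < 4 * s * (1 - s) := by nlinarith [hs.1, hs.2]
    nlinarith [Real.sin_sq_le_one (q 1 / 2), sq_nonneg (Real.sin (q 1 / 2))]
  have hR₀pos : ∀ s ∈ Ioo (0 : ℝ) 1, s ≠ 1 / 2 → 0 < 1 - 4 * s * (1 - s) * Real.sin (q 0 / 2) ^ 2 := by
    intro s hs hs2
    have h1 : 4 * s * (1 - s) < 1 := by nlinarith [sq_nonneg (2 * s - 1), sq_pos_of_ne_zero (sub_ne_zero.2 hs2)]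
    have h2 : 0 < 4 * s * (1 - s) := by nlinarith [hs.1, hs.2]
    nlinarith [Real.sin_sq_le_one (q 0 / 2), sq_nonneg (Real.sin (q 0 / 2))]
  have h6 : ∀ s ∈ Ioo (0 : ℝ) 1, s ≠ 1 / 2 → ∫⁻ x in Ico (-π) π, N s x = σ s := by
    intro s hs hs2
    simp only [hN, hσ]
    rw [sRep_inner_x_eq μ (q 0) (q 1) s ⟨hs.1.le, hs.2.le⟩,
      fermiCurveMeasure_anisoBand_univ _ _ μ (Real.sqrt_pos.2 (hR₁pos s hs hs2))]
  have h7 : ∫⁻ s in Ioo (0 : ℝ) 1, ∫⁻ x in Ico (-π) π, N s x = ∫⁻ s in Ioo (0 : ℝ) 1, σ s := by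
    refine setLIntegral_congr_fun_ae measurableSet_Ioo ?_
    refine (measure_eq_zero_iff_ae_notMem.1 hhalf).mono fun s hs2 hs => h6 s hs ?_
    simpa using hs2
  ---------------------------------------------------------------------------------------------
  -- Step 4: the right-hand side, `∫ toReal = toReal ∫⁻` (finiteness off the van Hove parameters)
  ---------------------------------------------------------------------------------------------
  have hσm : AEMeasurable σ (volume.restrict (Ioo (0 : ℝ) 1)) := by
    have hm : Measurable fun s => ∫⁻ x in Ico (-π) π, N s x := hNm'.lintegral_prod_right
    refine (hm.aemeasurable.congr ?_)
    refine (ae_restrict_iff' measurableSet_Ioo).2 ?_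
    refine (measure_eq_zero_iff_ae_notMem.1 hhalf).mono fun s hs2 hs => h6 s hs ?_
    simpa using hs2
  have hV := finite_setOf_vanHove μ (Real.sin (q 0 / 2) ^ 2) (Real.sin (q 1 / 2) ^ 2) hμ0.ne (by nlinarith)
    (sq_nonneg _) (Real.sin_sq_le_one _) (sq_nonneg _) (Real.sin_sq_le_one _)
  have hσfin : ∀ᵐ s ∂(volume.restrict (Ioo (0 : ℝ) 1)), σ s < ∞ := by
    have hnull : (volume : Measure ℝ) ({(1 / 2 : ℝ)} ∪ {s : ℝ | s ∈ Icc (0 : ℝ) 1 ∧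
        (μ = 2 * (Real.sqrt (1 - 4 * s * (1 - s) * Real.sin (q 0 / 2) ^ 2) - Real.sqrt (1 - 4 * s * (1 - s) * Real.sin (q 1 / 2) ^ 2)) ∨
         μ = 2 * (Real.sqrt (1 - 4 * s * (1 - s) * Real.sin (q 1 / 2) ^ 2) - Real.sqrt (1 - 4 * s * (1 - s) * Real.sin (q 0 / 2) ^ 2)))}) = 0 :=
      measure_union_null hhalf (hV.measure_zero _)
    refine (ae_restrict_iff' measurableSet_Ioo).2 ((measure_eq_zero_iff_ae_notMem.1 hnull).mono fun s hs hsI => ?_)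
    simp only [mem_union, mem_singleton_iff, mem_setOf_eq, not_or] at hs
    obtain ⟨hs2, hvh⟩ := hs
    have hs01 : s ∈ Icc (0 : ℝ) 1 := ⟨hsI.1.le, hsI.2.le⟩
    rw [← h6 s hsI hs2]
    simp only [hN]
    rw [sRep_inner_x_eq μ (q 0) (q 1) s hs01]
    refine lintegral_anisoDOS_lt_top _ _ μ (Real.sqrt_pos.2 (hR₀pos s hsI hs2)) (Real.sqrt_pos.2 (hR₁pos s hsI hs2))
      ?_ ?_
    · intro h; exact hvh ⟨hs01, Or.inr (by linarith)⟩
    · intro h; exact hvh ⟨hs01, Or.inl (by linarith)⟩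
  have h8 : (∫ s in (0 : ℝ)..1, (σ s).toReal) = (∫⁻ s in Ioo (0 : ℝ) 1, σ s).toReal := by
    rw [intervalIntegral.integral_of_le zero_le_one, setIntegral_congr_set Ioo_ae_eq_Ioc.symm,
      integral_toReal hσm hσfin]
  ---------------------------------------------------------------------------------------------
  -- assembly
  ---------------------------------------------------------------------------------------------
  unfold lindhardFunction
  rw [h1, h2, h3, h4, h5, h7, ← h8]

end Literature.MathematicalPhysics.QuantumLattice

end
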